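import Summits.MatrixMultiplication.MatrixMultiplication.Theorems.SoloInformedValFamily

/-!
# SoloInformedValFamilyFree — the sign-coherent family is equilateral trapezoid-free; solution count

Part 2 of `SoloInformedValFamily` (see its module docstring): the three systems of Pratt's Definition 3.2 for
`(X, Y, Z)` with variable moduli `b ≥ 2`, `m ≥ 4` (`sys1`, `sys2`, `sys3`, sixteen cases each, closed by the digit
uniqueness / disjointness lemmas of part 1), `trapezoidFree_XYZ`, and `card_solutions_ge`: at least
`(b-1)((m-2)(p-1) + (m-1)(q-1))` solutions of `u + v + w = 0` (two disjoint injective digit patterns).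
-/

namespace Summit.MatrixMultiplication.MatrixMultiplication.Theorems.SoloVal.Family

open Finset

variable {b m p q : ℤ}

/-! ## The three systems -/

/-- System (1): for fixed `a' ∈ X`, `b' ∈ Y` at most one `c`. -/
theorem sys1 (hb : 2 ≤ b) (hm : 4 ≤ m) : ∀ a' ∈ X b m q, ∀ b' ∈ Y b m p q, ∀ c₁ ∈ Z b m p, ∀ c₂ ∈ Z b m p,
    0 - a' - c₁ ∈ Y b m p q → 0 - b' - c₁ ∈ X b m q → 0 - a' - c₂ ∈ Y b m p q → 0 - b' - c₂ ∈ X b m q → c₁ = c₂ := by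
  have hb0 : 0 < b := by omega
  have hm0 : 0 < m := by omega
  intro a' ha' b' hb' c₁ hc₁ c₂ hc₂ h1 h2 h3 h4
  have T1 := tri hb hm ha' h1 hc₁ (by ring); have T2 := tri hb hm h2 hb' hc₁ (by ring)
  have T3 := tri hb hm ha' h3 hc₂ (by ring); have T4 := tri hb hm h4 hb' hc₂ (by ring)
  rcases T1 with ⟨x1, y1, c1, hx1, hy1, hc1, ea1, -, ec1⟩ | ⟨x1, y1, c1, hx1, hy1, hc1, ea1, -, ec1⟩ <;>
  rcases T2 with ⟨x2, y2, c2, hx2, hy2, hc2, -, eb2, ec2⟩ | ⟨x2, y2, c2, hx2, hy2, hc2, -, eb2, ec2⟩ <;>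
  rcases T3 with ⟨x3, y3, c3, hx3, hy3, hc3, ea3, -, ec3⟩ | ⟨x3, y3, c3, hx3, hy3, hc3, ea3, -, ec3⟩ <;>
  rcases T4 with ⟨x4, y4, c4, hx4, hy4, hc4, -, eb4, ec4⟩ | ⟨x4, y4, c4, hx4, hy4, hc4, -, eb4, ec4⟩ <;>
  first
  -- `a'` in both words
  | exact (D_bot hb0 (K := m * c3 - y3 - y1) hx1 (by linear_combination ea3.symm.trans ea1)).elim
  | exact (D_bot hb0 (K := m * c1 - y1 - y3) hx3 (by linear_combination ea1.symm.trans ea3)).elim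
  -- `b'` in both words
  | exact (D_bot hb0 (K := m * c4 - m * c2 - y2) hx4 (by linear_combination eb2.symm.trans eb4)).elim
  | exact (D_bot hb0 (K := m * c2 - m * c4 - y4) hx2 (by linear_combination eb4.symm.trans eb2)).elim
  -- `c₁` resp. `c₂` in both words
  | exact (D_Z hb0 hm0 hc1.1 hx1 hx2 hy2 (ec1.symm.trans ec2)).elim
  | exact (D_Z hb0 hm0 hc2.1 hx2 hx1 hy1 (ec2.symm.trans ec1)).elim
  | exact (D_Z hb0 hm0 hc3.1 hx3 hx4 hy4 (ec3.symm.trans ec4)).elim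
  | exact (D_Z hb0 hm0 hc4.1 hx4 hx3 hy3 (ec4.symm.trans ec3)).elim
  -- everything in word 1
  | (obtain ⟨f1, f2⟩ := U_X1 hb0 hx1 hx3 (ea1.symm.trans ea3)
     obtain ⟨f3, f4⟩ := U_Z1 hb0 hm0 hx1 hx2 (ec1.symm.trans ec2)
     obtain ⟨f5, f6⟩ := U_Z1 hb0 hm0 hx3 hx4 (ec3.symm.trans ec4)
     obtain ⟨f7, f8⟩ := U_Y1 hb0 hm0 hy2 hy4 (eb2.symm.trans eb4)
     rw [ec1, ec3, f3, f7, ← f5, f2])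
  -- everything in word 2
  | (obtain ⟨f1, f2⟩ := U_X2 hb0 hm0 hy1 hy3 (ea1.symm.trans ea3)
     obtain ⟨f3, f4⟩ := U_Z2 hb0 hx1 hx2 (ec1.symm.trans ec2)
     obtain ⟨f5, f6⟩ := U_Z2 hb0 hx3 hx4 (ec3.symm.trans ec4)
     obtain ⟨f7, f8⟩ := U_Y2 hb0 hm0 hx2 hx4 (eb2.symm.trans eb4)
     rw [ec1, ec3, f2, f4, f7, ← f6])


/-- System (2): for fixed `a' ∈ X`, `c' ∈ Z` at most one `b`. -/
theorem sys2 (hb : 2 ≤ b) (hm : 4 ≤ m) : ∀ a' ∈ X b m q, ∀ c' ∈ Z b m p, ∀ b₁ ∈ Y b m p q, ∀ b₂ ∈ Y b m p q,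
    0 - a' - b₁ ∈ Z b m p → 0 - c' - b₁ ∈ X b m q → 0 - a' - b₂ ∈ Z b m p → 0 - c' - b₂ ∈ X b m q → b₁ = b₂ := by
  have hb0 : 0 < b := by omega
  have hm0 : 0 < m := by omega
  intro a' ha' c' hc' b₁ hb₁ b₂ hb₂ h1 h2 h3 h4
  have T1 := tri hb hm ha' hb₁ h1 (by ring); have T2 := tri hb hm h2 hb₁ hc' (by ring)
  have T3 := tri hb hm ha' hb₂ h3 (by ring); have T4 := tri hb hm h4 hb₂ hc' (by ring)
  rcases T1 with ⟨x1, y1, c1, hx1, hy1, hc1, ea1, eb1, -⟩ | ⟨x1, y1, c1, hx1, hy1, hc1, ea1, eb1, -⟩ <;>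
  rcases T2 with ⟨x2, y2, c2, hx2, hy2, hc2, -, eb2, ec2⟩ | ⟨x2, y2, c2, hx2, hy2, hc2, -, eb2, ec2⟩ <;>
  rcases T3 with ⟨x3, y3, c3, hx3, hy3, hc3, ea3, eb3, -⟩ | ⟨x3, y3, c3, hx3, hy3, hc3, ea3, eb3, -⟩ <;>
  rcases T4 with ⟨x4, y4, c4, hx4, hy4, hc4, -, eb4, ec4⟩ | ⟨x4, y4, c4, hx4, hy4, hc4, -, eb4, ec4⟩ <;>
  first
  -- `a'` in both words
  | exact (D_bot hb0 (K := m * c3 - y3 - y1) hx1 (by linear_combination ea3.symm.trans ea1)).elim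
  | exact (D_bot hb0 (K := m * c1 - y1 - y3) hx3 (by linear_combination ea1.symm.trans ea3)).elim
  -- `c'` in both words
  | exact (D_Z hb0 hm0 hc2.1 hx2 hx4 hy4 (ec2.symm.trans ec4)).elim
  | exact (D_Z hb0 hm0 hc4.1 hx4 hx2 hy2 (ec4.symm.trans ec2)).elim
  -- `b₁` resp. `b₂` in both words
  | exact (D_bot hb0 (K := m * c2 - m * c1 - y1) hx2 (by linear_combination eb1.symm.trans eb2)).elim
  | exact (D_bot hb0 (K := m * c1 - m * c2 - y2) hx1 (by linear_combination eb2.symm.trans eb1)).elim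
  | exact (D_bot hb0 (K := m * c4 - m * c3 - y3) hx4 (by linear_combination eb3.symm.trans eb4)).elim
  | exact (D_bot hb0 (K := m * c3 - m * c4 - y4) hx3 (by linear_combination eb4.symm.trans eb3)).elim
  -- everything in word 1
  | (obtain ⟨f1, f2⟩ := U_Y1 hb0 hm0 hy1 hy2 (eb1.symm.trans eb2)
     obtain ⟨f3, f4⟩ := U_Y1 hb0 hm0 hy3 hy4 (eb3.symm.trans eb4)
     obtain ⟨f5, f6⟩ := U_X1 hb0 hx1 hx3 (ea1.symm.trans ea3)
     obtain ⟨f7, f8⟩ := U_Z1 hb0 hm0 hx2 hx4 (ec2.symm.trans ec4)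
     rw [eb1, eb3, f1, f7, ← f3, f5])
  -- everything in word 2
  | (obtain ⟨f1, f2⟩ := U_Y2 hb0 hm0 hx1 hx2 (eb1.symm.trans eb2)
     obtain ⟨f3, f4⟩ := U_Y2 hb0 hm0 hx3 hx4 (eb3.symm.trans eb4)
     obtain ⟨f5, f6⟩ := U_X2 hb0 hm0 hy1 hy3 (ea1.symm.trans ea3)
     obtain ⟨f7, f8⟩ := U_Z2 hb0 hx2 hx4 (ec2.symm.trans ec4)
     rw [eb1, eb3, f5, f1, f8, ← f3])

/-- System (3): for fixed `b' ∈ Y`, `c' ∈ Z` at most one `a`. -/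
theorem sys3 (hb : 2 ≤ b) (hm : 4 ≤ m) : ∀ b' ∈ Y b m p q, ∀ c' ∈ Z b m p, ∀ a₁ ∈ X b m q, ∀ a₂ ∈ X b m q,
    0 - b' - a₁ ∈ Z b m p → 0 - c' - a₁ ∈ Y b m p q → 0 - b' - a₂ ∈ Z b m p → 0 - c' - a₂ ∈ Y b m p q → a₁ = a₂ := by
  have hb0 : 0 < b := by omega
  have hm0 : 0 < m := by omega
  intro b' hb' c' hc' a₁ ha₁ a₂ ha₂ h1 h2 h3 h4
  have T1 := tri hb hm ha₁ hb' h1 (by ring); have T2 := tri hb hm ha₁ h2 hc' (by ring)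
  have T3 := tri hb hm ha₂ hb' h3 (by ring); have T4 := tri hb hm ha₂ h4 hc' (by ring)
  rcases T1 with ⟨x1, y1, c1, hx1, hy1, hc1, ea1, eb1, -⟩ | ⟨x1, y1, c1, hx1, hy1, hc1, ea1, eb1, -⟩ <;>
  rcases T2 with ⟨x2, y2, c2, hx2, hy2, hc2, ea2, -, ec2⟩ | ⟨x2, y2, c2, hx2, hy2, hc2, ea2, -, ec2⟩ <;>
  rcases T3 with ⟨x3, y3, c3, hx3, hy3, hc3, ea3, eb3, -⟩ | ⟨x3, y3, c3, hx3, hy3, hc3, ea3, eb3, -⟩ <;>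
  rcases T4 with ⟨x4, y4, c4, hx4, hy4, hc4, ea4, -, ec4⟩ | ⟨x4, y4, c4, hx4, hy4, hc4, ea4, -, ec4⟩ <;>
  first
  -- `a₁` resp. `a₂` in both words
  | exact (D_bot hb0 (K := m * c2 - y2 - y1) hx1 (by linear_combination ea2.symm.trans ea1)).elim
  | exact (D_bot hb0 (K := m * c1 - y1 - y2) hx2 (by linear_combination ea1.symm.trans ea2)).elim
  | exact (D_bot hb0 (K := m * c4 - y4 - y3) hx3 (by linear_combination ea4.symm.trans ea3)).elim
  | exact (D_bot hb0 (K := m * c3 - y3 - y4) hx4 (by linear_combination ea3.symm.trans ea4)).elim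
  -- `b'` in both words
  | exact (D_bot hb0 (K := m * c3 - m * c1 - y1) hx3 (by linear_combination eb1.symm.trans eb3)).elim
  | exact (D_bot hb0 (K := m * c1 - m * c3 - y3) hx1 (by linear_combination eb3.symm.trans eb1)).elim
  -- `c'` in both words
  | exact (D_Z hb0 hm0 hc2.1 hx2 hx4 hy4 (ec2.symm.trans ec4)).elim
  | exact (D_Z hb0 hm0 hc4.1 hx4 hx2 hy2 (ec4.symm.trans ec2)).elim
  -- everything in word 1
  | (obtain ⟨f1, f2⟩ := U_X1 hb0 hx1 hx2 (ea1.symm.trans ea2)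
     obtain ⟨f3, f4⟩ := U_X1 hb0 hx3 hx4 (ea3.symm.trans ea4)
     obtain ⟨f5, f6⟩ := U_Y1 hb0 hm0 hy1 hy3 (eb1.symm.trans eb3)
     obtain ⟨f7, f8⟩ := U_Z1 hb0 hm0 hx2 hx4 (ec2.symm.trans ec4)
     rw [ea1, ea3, f6, f2, f8, ← f4])
  -- everything in word 2
  | (obtain ⟨f1, f2⟩ := U_X2 hb0 hm0 hy1 hy2 (ea1.symm.trans ea2)
     obtain ⟨f3, f4⟩ := U_X2 hb0 hm0 hy3 hy4 (ea3.symm.trans ea4)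
     obtain ⟨f5, f6⟩ := U_Y2 hb0 hm0 hx1 hx3 (eb1.symm.trans eb3)
     obtain ⟨f7, f8⟩ := U_Z2 hb0 hx2 hx4 (ec2.symm.trans ec4)
     rw [ea1, ea3, f6, f2, f7, ← f4])

/-- `(X, Y, Z)` is equilateral trapezoid-free for the target `0`, for all parameters `b ≥ 2`, `m ≥ 4`. -/
theorem trapezoidFree_XYZ (hb : 2 ≤ b) (hm : 4 ≤ m) : TrapezoidFree (X b m q) (Y b m p q) (Z b m p) 0 :=
  And.intro (sys1 hb hm) (And.intro (sys2 hb hm) (sys3 hb hm))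

/-! ## Counting the solutions -/

variable (b m p q)

/-- Index set of pattern 1: `(x, y, c)`. -/
noncomputable def src1 : Finset (ℤ × ℤ × ℤ) := Icc 1 (b - 1) ×ˢ Icc 1 (m - 2) ×ˢ Icc 2 p
/-- Index set of pattern 2: `(x, y', z)`. -/
noncomputable def src2 : Finset (ℤ × ℤ × ℤ) := Icc 1 (b - 1) ×ˢ Icc 1 (m - 1) ×ˢ Icc 2 q
/-- Pattern 1 solutions. -/
def emb1 (e : ℤ × ℤ × ℤ) : ℤ × ℤ × ℤ := (b * e.2.1 + e.1, -(b * m * e.2.2) - b * e.2.1, b * m * e.2.2 - e.1)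
/-- Pattern 2 solutions. -/
def emb2 (e : ℤ × ℤ × ℤ) : ℤ × ℤ × ℤ := (b * m * e.2.2 - b * e.2.1, e.1 - b * m * e.2.2, b * e.2.1 - e.1)

variable {b m p q}

/-- `|src1| = (b-1)(m-2)(p-1)`. -/
theorem card_src1 (hb : 2 ≤ b) (hm : 4 ≤ m) (hp : 2 ≤ p) : ((src1 b m p).card : ℤ) = (b - 1) * ((m - 2) * (p - 1)) := by
  have e1 : ((b - 1 + 1 - 1).toNat : ℤ) = b - 1 := by
    rw [Int.toNat_of_nonneg (show (0 : ℤ) ≤ b - 1 + 1 - 1 by omega)]; ring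
  have e2 : ((m - 2 + 1 - 1).toNat : ℤ) = m - 2 := by
    rw [Int.toNat_of_nonneg (show (0 : ℤ) ≤ m - 2 + 1 - 1 by omega)]; ring
  have e3 : ((p + 1 - 2).toNat : ℤ) = p - 1 := by rw [Int.toNat_of_nonneg (show (0 : ℤ) ≤ p + 1 - 2 by omega)]; ring
  simp only [src1, card_product, Int.card_Icc]; push_cast; rw [e1, e2, e3]

/-- `|src2| = (b-1)(m-1)(q-1)`. -/
theorem card_src2 (hb : 2 ≤ b) (hm : 4 ≤ m) (hq : 2 ≤ q) : ((src2 b m q).card : ℤ) = (b - 1) * ((m - 1) * (q - 1)) := by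
  have e1 : ((b - 1 + 1 - 1).toNat : ℤ) = b - 1 := by
    rw [Int.toNat_of_nonneg (show (0 : ℤ) ≤ b - 1 + 1 - 1 by omega)]; ring
  have e2 : ((m - 1 + 1 - 1).toNat : ℤ) = m - 1 := by
    rw [Int.toNat_of_nonneg (show (0 : ℤ) ≤ m - 1 + 1 - 1 by omega)]; ring
  have e3 : ((q + 1 - 2).toNat : ℤ) = q - 1 := by rw [Int.toNat_of_nonneg (show (0 : ℤ) ≤ q + 1 - 2 by omega)]; ring
  simp only [src2, card_product, Int.card_Icc]; push_cast; rw [e1, e2, e3]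

/-- Membership in `src1`. -/
theorem mem_src1 {e : ℤ × ℤ × ℤ} : e ∈ src1 b m p ↔
    (1 ≤ e.1 ∧ e.1 ≤ b - 1) ∧ (1 ≤ e.2.1 ∧ e.2.1 ≤ m - 2) ∧ (2 ≤ e.2.2 ∧ e.2.2 ≤ p) := by
  simp only [src1, mem_product, mem_Icc]

/-- Membership in `src2`. -/
theorem mem_src2 {e : ℤ × ℤ × ℤ} : e ∈ src2 b m q ↔
    (1 ≤ e.1 ∧ e.1 ≤ b - 1) ∧ (1 ≤ e.2.1 ∧ e.2.1 ≤ m - 1) ∧ (2 ≤ e.2.2 ∧ e.2.2 ≤ q) := by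
  simp only [src2, mem_product, mem_Icc]

/-- Pattern 1 lands in the solution set. -/
theorem emb1_mem {e : ℤ × ℤ × ℤ} (he : e ∈ src1 b m p) : emb1 b m e ∈ solutions (X b m q) (Y b m p q) (Z b m p) 0 := by
  obtain ⟨hx, hy, hc⟩ := mem_src1.1 he
  rw [emb1, solutions, mem_filter]
  refine ⟨?_, by ring⟩
  simp only [mem_product, X, Y, Z, mem_union]
  exact ⟨Or.inl (mem_X1.2 ⟨_, _, hy, hx, rfl⟩), Or.inl (mem_Y1.2 ⟨_, _, hc, hy, rfl⟩),
    Or.inl (mem_Z1.2 ⟨_, _, hc, hx, rfl⟩)⟩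

/-- Pattern 2 lands in the solution set. -/
theorem emb2_mem {e : ℤ × ℤ × ℤ} (he : e ∈ src2 b m q) : emb2 b m e ∈ solutions (X b m q) (Y b m p q) (Z b m p) 0 := by
  obtain ⟨hx, hy, hz⟩ := mem_src2.1 he
  rw [emb2, solutions, mem_filter]
  refine ⟨?_, by ring⟩
  simp only [mem_product, X, Y, Z, mem_union]
  exact ⟨Or.inr (mem_X2.2 ⟨_, _, hz, hy, rfl⟩), Or.inr (mem_Y2.2 ⟨_, _, hx, hz, rfl⟩),
    Or.inr (mem_Z2.2 ⟨_, _, hy, hx, rfl⟩)⟩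

/-- Pattern 1 is injective (digits are determined). -/
theorem emb1_injOn (hb : 2 ≤ b) (hm : 4 ≤ m) : Set.InjOn (emb1 b m) (src1 b m p : Set (ℤ × ℤ × ℤ)) := by
  have hb0 : 0 < b := by omega
  have hm0 : 0 < m := by omega
  rintro ⟨x, y, c⟩ he ⟨x', y', c'⟩ he' h
  rw [mem_coe] at he he'
  obtain ⟨hx, hy, hc⟩ := mem_src1.1 he; obtain ⟨hx', hy', hc'⟩ := mem_src1.1 he'
  simp only [emb1, Prod.mk.injEq] at h hx hy hc hx' hy' hc' ⊢
  obtain ⟨h1, -, h3⟩ := h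
  obtain ⟨f1, f2⟩ := U_X1 hb0 hx hx' h1
  obtain ⟨f3, -⟩ := U_Z1 hb0 hm0 hx hx' h3
  exact ⟨f2, f1, f3⟩

/-- Pattern 2 is injective. -/
theorem emb2_injOn (hb : 2 ≤ b) (hm : 4 ≤ m) : Set.InjOn (emb2 b m) (src2 b m q : Set (ℤ × ℤ × ℤ)) := by
  have hb0 : 0 < b := by omega
  have hm0 : 0 < m := by omega
  rintro ⟨x, y, z⟩ he ⟨x', y', z'⟩ he' h
  rw [mem_coe] at he he'
  obtain ⟨hx, hy, hz⟩ := mem_src2.1 he; obtain ⟨hx', hy', hz'⟩ := mem_src2.1 he'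
  simp only [emb2, Prod.mk.injEq] at h hx hy hz hx' hy' hz' ⊢
  obtain ⟨h1, h2, -⟩ := h
  obtain ⟨f1, f2⟩ := U_X2 hb0 hm0 hy hy' h1
  obtain ⟨f3, -⟩ := U_Y2 hb0 hm0 hx hx' h2
  exact ⟨f3, f2, f1⟩

/-- The two solution families are disjoint (`X₁ ∩ X₂ = ∅`). -/
theorem disjoint_images (hb : 2 ≤ b) :
    Disjoint ((src1 b m p).image (emb1 b m)) ((src2 b m q).image (emb2 b m)) := by
  have hb0 : 0 < b := by omega
  rw [Finset.disjoint_left]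
  intro s h1 h2
  obtain ⟨⟨x, y, c⟩, he, rfl⟩ := mem_image.1 h1
  obtain ⟨⟨x', y', z'⟩, he', h⟩ := mem_image.1 h2
  obtain ⟨hx, -, -⟩ := mem_src1.1 he
  simp only [emb1, emb2, Prod.mk.injEq] at h hx
  exact D_bot hb0 (K := m * z' - y' - y) hx (by linear_combination h.1)

/-- `a + b + c = 0` has at least `(b-1)((m-2)(p-1) + (m-1)(q-1))` solutions in `X × Y × Z`. -/
theorem card_solutions_ge (hb : 2 ≤ b) (hm : 4 ≤ m) (hp : 2 ≤ p) (hq : 2 ≤ q) :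
    (b - 1) * ((m - 2) * (p - 1)) + (b - 1) * ((m - 1) * (q - 1)) ≤
      ((solutions (X b m q) (Y b m p q) (Z b m p) 0).card : ℤ) := by
  have h1 : (((src1 b m p).image (emb1 b m)).card : ℤ) = (b - 1) * ((m - 2) * (p - 1)) := by
    rw [card_image_of_injOn (emb1_injOn hb hm), card_src1 hb hm hp]
  have h2 : (((src2 b m q).image (emb2 b m)).card : ℤ) = (b - 1) * ((m - 1) * (q - 1)) := by
    rw [card_image_of_injOn (emb2_injOn hb hm), card_src2 hb hm hq]
  have hsub : (src1 b m p).image (emb1 b m) ∪ (src2 b m q).image (emb2 b m) ⊆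
      solutions (X b m q) (Y b m p q) (Z b m p) 0 := by
    intro s hs
    rcases mem_union.1 hs with hs | hs
    · obtain ⟨e, he, rfl⟩ := mem_image.1 hs
      exact emb1_mem he
    · obtain ⟨e, he, rfl⟩ := mem_image.1 hs
      exact emb2_mem he
  have := card_le_card hsub
  rw [card_union_of_disjoint (disjoint_images hb)] at this
  rw [← h1, ← h2]
  exact_mod_cast this

end Summit.MatrixMultiplication.MatrixMultiplication.Theorems.SoloVal.Family
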